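import Mathlib
import Literature.Analysis.UnboundedOperators.ConjugateOperatorRegularity
import Literature.Analysis.UnboundedOperators.UnitaryRepSpectralMeasure
import Literature.Analysis.UnboundedOperators.FourierSpectrumCalculus
import Literature.Analysis.UnboundedOperators.StrongContRepresentationClosedProofs
import HarnessLib
import Summits.AtomisticToContinuum.FouriersLaw.Theorems.EmbeddedDrudeMourreMourreDissolutionLAPCalculus

/-!
# Stub `stub_mourreThresholdLAP` — Mourre LAP infrastructure 5: resolvent calculus, both half-planes

Item `stmt-AtomisticToContinuum-12594` (crux `MourreDissolution` of route `EmbeddedDrudeMourre`,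
sub-problem `FouriersLaw`), line `separable-vertex-faddeev-pair-sector`, stub S6
`stub_mourreThresholdLAP` (Mourre's limiting absorption principle; NOT in the tree). This file is
the first half of step L1 of the proof map: the resolvent `R(z) = resolventAt U z = (H - z)⁻¹` of
the Stone Hamiltonian of `U(t) = e^{itH}`, realised through the group (Laplace transforms of the
group, Hille–Yosida style; no spectral theorem), at EVERY non-real `z`:

* §1 the upper half-plane (`R(z) = i∫_{-∞}^0 e^{-izt} U(t) dt`, `‖R(z)‖ ≤ 1/|Im z|`) and the adjoint
  relation `R(z)* = R(z̄)` (`⟪R(z) f, g⟫ = ⟪f, R(z̄) g⟫`, from `U[k]* = U[k†]`);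
* §2 `R(z)` against the generator: `R(z)(iH x) = i x + i z R(z) x` and `R(z)(H - z) x = x` on
  `D(H)` for both half-planes (integration by parts), `R(z)` commutes with the group and preserves
  `D(H)`, and — by closedness of the generator and density of `D(H)` — `R(z)` maps ALL of the
  space into `D(H)` with `(H - z) R(z) f = f` (headline `hamiltonian_resolventAt_apply`);
* §3 `resolventAt U (-i) = resolventNegI U`, identifying the tree's regularity hypotheses
  `HamiltonianOfClassC1/C11 U A` (stated on `resolventNegI`) with statements about `R(-i)`.

The first resolvent identity and its consequences are in `…LAPResolventIdentity`.
References: Reed–Simon I Thm VIII.7 (proof), Engel–Nagel Ch. II Thm 1.10, ABG Lemma 6.2.1.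
-/

noncomputable section

open MeasureTheory Complex Filter Topology Set
open scoped InnerProductSpace ComplexConjugate SchwartzMap FourierTransform ENNReal NNReal

namespace Summit.AtomisticToContinuum.FouriersLaw.Theorems.MourreDissolution

open Literature.Analysis.UnboundedOperators
open Literature.Analysis.UnboundedOperators.UnitaryRep

variable {H : Type*} [NormedAddCommGroup H] [InnerProductSpace ℂ H] [CompleteSpace H]

/-! ## §1. The upper half-plane and the adjoint relation `R(z)* = R(z̄)` -/

/-- The resolvent kernel is integrable for every non-real `z`. [folklore] -/
theorem integrable_resolventKernelAt_of_ne {z : ℂ} (hz : z.im ≠ 0) :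
    Integrable (resolventKernelAt z) := by
  rcases lt_or_gt_of_ne hz with h | h
  · exact integrable_resolventKernelAt h
  · exact integrable_resolventKernelAt_of_pos h

/-- `(H - z)⁻¹ f = ∫ k_z(t) • U(t) f dt` for every non-real `z`. [folklore] -/
theorem resolventAt_apply_of_ne {z : ℂ} (hz : z.im ≠ 0) (U : OneParameterUnitaryGroup H) (f : H) :
    resolventAt U z f = ∫ t, resolventKernelAt z t • U.appReal t f :=
  U.smear_apply (integrable_resolventKernelAt_of_ne hz) f

/-- The resolvent as an integral over `(-∞, 0]` for `Im z > 0`: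
`(H - z)⁻¹ f = -∫_{-∞}^0 (-i e^{-izt}) • U(t) f dt = i ∫_{-∞}^0 e^{-izt} U(t) f dt`. [folklore] -/
theorem resolventAt_apply_eq_neg_setIntegral {z : ℂ} (hz : 0 < z.im)
    (U : OneParameterUnitaryGroup H) (f : H) :
    resolventAt U z f = -∫ t in Set.Iic 0, negIExpAt z t • U.appReal t f := by
  rw [resolventAt_apply_of_ne hz.ne' U f, resolventKernelAt_eq_indicator_of_nonneg hz.le,
    ← integral_neg, ← integral_indicator measurableSet_Iic]
  congr 1
  funext t
  by_cases ht : t ∈ Set.Iic (0 : ℝ) <;> simp [ht]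

/-- The smeared orbit with the smooth kernel is integrable on `(-∞, 0]` for `Im z > 0`. [folklore] -/
theorem integrableOn_negIExpAt_smul_appReal_Iic {z : ℂ} (hz : 0 < z.im)
    (U : OneParameterUnitaryGroup H) (f : H) :
    IntegrableOn (fun t : ℝ => negIExpAt z t • U.appReal t f) (Set.Iic 0) := by
  have h := ((U.integrable_smul_appReal (integrable_resolventKernelAt_of_pos hz) f).integrableOn
    (s := Set.Iic 0)).neg
  refine h.congr_fun (fun t ht => ?_) measurableSet_Iic
  simp only [Pi.neg_apply, resolventKernelAt_eq_indicator_of_nonneg hz.le,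
    Set.indicator_of_mem ht, neg_smul, neg_neg]

/-- **`‖(H - z)⁻¹‖ ≤ 1/Im z` for `Im z > 0`** (`‖k_z‖₁ = ∫_{-∞}^0 e^{(Im z)t} dt = 1/Im z`).
[folklore] -/
theorem norm_resolventAt_le_of_pos {z : ℂ} (hz : 0 < z.im) (U : OneParameterUnitaryGroup H) :
    ‖resolventAt U z‖ ≤ 1 / z.im := by
  refine (U.norm_smear_le _).trans (le_of_eq ?_)
  rw [resolventKernelAt_eq_indicator_of_nonneg hz.le]
  have : (fun a => ‖(Set.Iic (0:ℝ)).indicator (fun t => -negIExpAt z t) a‖) =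
      (Set.Iic (0:ℝ)).indicator fun a => Real.exp (z.im * a) := by
    funext a
    by_cases ha : a ∈ Set.Iic (0:ℝ) <;> simp [ha, norm_negIExpAt]
  rw [this, integral_indicator measurableSet_Iic, integral_exp_mul_Iic hz 0]
  simp

/-- **`‖(H - z)⁻¹‖ ≤ 1/|Im z|`** for every non-real `z`. [folklore] -/
theorem norm_resolventAt_le_inv_abs {z : ℂ} (hz : z.im ≠ 0) (U : OneParameterUnitaryGroup H) :
    ‖resolventAt U z‖ ≤ |z.im|⁻¹ := by
  rcases lt_or_gt_of_ne hz with h | h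
  · rw [abs_of_neg h, ← one_div]; exact norm_resolventAt_le h U
  · rw [abs_of_pos h, ← one_div]; exact norm_resolventAt_le_of_pos h U

/-- `‖(H - z)⁻¹ f‖ ≤ ‖f‖/|Im z|`. [folklore] -/
theorem norm_resolventAt_apply_le {z : ℂ} (hz : z.im ≠ 0) (U : OneParameterUnitaryGroup H) (f : H) :
    ‖resolventAt U z f‖ ≤ |z.im|⁻¹ * ‖f‖ :=
  (resolventAt U z).le_of_opNorm_le (norm_resolventAt_le_inv_abs hz U) f

/-- **The adjoint relation `R(z)* = R(z̄)`**: `⟪(H - z)⁻¹ f, g⟫ = ⟪f, (H - z̄)⁻¹ g⟫` for non-real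
`z` (`U[k]* = U[k†]` with `k†(a) = conj k(-a)`, and `k_z† = k_{z̄}`). [folklore] -/
theorem inner_resolventAt_left {z : ℂ} (hz : z.im ≠ 0) (U : OneParameterUnitaryGroup H)
    (f g : H) : ⟪resolventAt U z f, g⟫_ℂ = ⟪f, resolventAt U (conj z) g⟫_ℂ := by
  have hz' : (conj z).im ≠ 0 := by rw [Complex.conj_im]; exact neg_ne_zero.2 hz
  rw [resolventAt_apply_of_ne hz, resolventAt_apply_of_ne hz',
    U.inner_integral_smul_appReal_left (integrable_resolventKernelAt_of_ne hz)]
  congr 1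
  refine integral_congr_ae (ae_of_all _ fun a => ?_)
  simp only
  rw [resolventKernelAt_conj hz]

/-- `⟪f, (H - z)⁻¹ g⟫ = ⟪(H - z̄)⁻¹ f, g⟫`. [folklore] -/
theorem inner_resolventAt_right {z : ℂ} (hz : z.im ≠ 0) (U : OneParameterUnitaryGroup H)
    (f g : H) : ⟪f, resolventAt U z g⟫_ℂ = ⟪resolventAt U (conj z) f, g⟫_ℂ := by
  have hz' : (conj z).im ≠ 0 := by rw [Complex.conj_im]; exact neg_ne_zero.2 hz
  rw [inner_resolventAt_left hz', Complex.conj_conj]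

/-- **`R(z)* = R(z̄)`** as an identity of bounded operators. [folklore] -/
theorem adjoint_resolventAt {z : ℂ} (hz : z.im ≠ 0) (U : OneParameterUnitaryGroup H) :
    ContinuousLinearMap.adjoint (resolventAt U z) = resolventAt U (conj z) := by
  refine ContinuousLinearMap.ext fun g => ?_
  refine ext_inner_left ℂ fun f => ?_
  rw [ContinuousLinearMap.adjoint_inner_right]
  exact inner_resolventAt_left hz U f g

/-- `⟪f, R(z̄) f⟫ = conj ⟪f, R(z) f⟫`. [folklore] -/
theorem inner_resolventAt_conj_self {z : ℂ} (hz : z.im ≠ 0) (U : OneParameterUnitaryGroup H)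
    (f : H) : ⟪f, resolventAt U (conj z) f⟫_ℂ = conj ⟪f, resolventAt U z f⟫_ℂ := by
  rw [← inner_resolventAt_left hz, inner_conj_symm]

/-! ## §2. `R(z)` against the generator; `(H - z) R(z) = 1` on the whole space -/

/-- **`(H - z)⁻¹` on the generator side, `Im z > 0`**: for `x ∈ D(H)`,
`R(z)(iH x) = i x + i z R(z) x` (integration by parts of `∫_{-∞}^0 -i e^{-izt} d/dt(U(t)x) dt`).
[folklore] -/
theorem resolventAt_generator_of_pos {z : ℂ} (hz : 0 < z.im) (U : OneParameterUnitaryGroup H)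
    (x : (OneParameterGroup.generator U.toStrongContRepresentation).domain) :
    resolventAt U z (OneParameterGroup.generator U.toStrongContRepresentation x) =
      I • (x : H) + (I * z) • resolventAt U z x := by
  set F : ℝ → H := fun t => negIExpAt z t • U.appReal t (x : H) with hF
  have hderiv : ∀ t, HasDerivAt F
      (negIExpAt z t • U.appReal t (OneParameterGroup.generator U.toStrongContRepresentation x) +
        ((-(I * z)) * negIExpAt z t) • U.appReal t (x : H)) t := fun t =>
    (hasDerivAt_negIExpAt z t).smul (U.hasDerivAt_appReal_apply x t)
  have hlim : Tendsto F atBot (𝓝 0) := by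
    rw [tendsto_zero_iff_norm_tendsto_zero]
    have h : (fun t => ‖F t‖) = fun t => Real.exp (z.im * t) * ‖(x : H)‖ := by
      funext t
      simp only [hF, norm_smul, norm_negIExpAt, norm_appReal]
    rw [h]
    have h0 : Tendsto (fun t : ℝ => Real.exp (z.im * t)) atBot (𝓝 0) :=
      Real.tendsto_exp_atBot.comp (tendsto_id.const_mul_atBot hz)
    simpa using h0.mul_const ‖(x : H)‖
  have hint1 := integrableOn_negIExpAt_smul_appReal_Iic hz U
    (OneParameterGroup.generator U.toStrongContRepresentation x)
  have hint2 : IntegrableOn (fun t : ℝ => ((-(I * z)) * negIExpAt z t) • U.appReal t (x : H))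
      (Set.Iic 0) := by
    refine IntegrableOn.congr_fun ((integrableOn_negIExpAt_smul_appReal_Iic hz U (x : H)).smul
      (-(I * z))) (fun t _ => ?_) measurableSet_Iic
    simp only [Pi.smul_apply, smul_smul]
  have hFTC := integral_Iic_of_hasDerivAt_of_tendsto' (fun t _ => hderiv t) (hint1.add hint2) hlim
  have hF0 : F 0 = (-I) • (x : H) := by
    simp [hF, negIExpAt]
  rw [integral_add hint1 hint2, hF0, sub_zero] at hFTC
  have hsmul : ∫ t in Set.Iic 0, ((-(I * z)) * negIExpAt z t) • U.appReal t (x : H) =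
      (-(I * z)) • ∫ t in Set.Iic 0, negIExpAt z t • U.appReal t (x : H) := by
    rw [← integral_smul]
    congr 1
    funext t
    rw [smul_smul]
  rw [hsmul] at hFTC
  rw [resolventAt_apply_eq_neg_setIntegral hz, resolventAt_apply_eq_neg_setIntegral hz,
    eq_sub_of_add_eq hFTC]
  simp only [neg_smul, smul_neg, sub_neg_eq_add, neg_add, neg_neg]

/-- **`R(z)(iH x) = i x + i z R(z) x` on `D(H)` for every non-real `z`.** [folklore] -/
theorem resolventAt_generator_of_ne {z : ℂ} (hz : z.im ≠ 0) (U : OneParameterUnitaryGroup H)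
    (x : (OneParameterGroup.generator U.toStrongContRepresentation).domain) :
    resolventAt U z (OneParameterGroup.generator U.toStrongContRepresentation x) =
      I • (x : H) + (I * z) • resolventAt U z x := by
  rcases lt_or_gt_of_ne hz with h | h
  · exact resolventAt_generator h U x
  · exact resolventAt_generator_of_pos h U x

/-- **`(H - z)⁻¹ (H - z) x = x` for `x ∈ D(H)` and every non-real `z`.** [folklore] -/
theorem resolventAt_hamiltonian_sub_of_ne {z : ℂ} (hz : z.im ≠ 0) (U : OneParameterUnitaryGroup H)
    (x : U.hamiltonian.domain) :
    resolventAt U z (U.hamiltonian x - z • (x : H)) = x := by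
  rw [hamiltonian_apply, map_sub, map_smul, map_smul, resolventAt_generator_of_ne hz U x, smul_add,
    smul_smul, smul_smul]
  have h1 : -I * I = (1 : ℂ) := by rw [neg_mul, Complex.I_mul_I, neg_neg]
  have h2 : -I * (I * z) = z := by rw [← mul_assoc, h1, one_mul]
  rw [h1, h2, one_smul]
  abel

/-- **`R(z)` commutes with the group**: `R(z) (U(t) f) = U(t) (R(z) f)`. [folklore] -/
theorem resolventAt_appReal {z : ℂ} (hz : z.im ≠ 0) (U : OneParameterUnitaryGroup H) (t : ℝ)
    (f : H) : resolventAt U z (U.appReal t f) = U.appReal t (resolventAt U z f) := by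
  rw [resolventAt_apply_of_ne hz, resolventAt_apply_of_ne hz,
    U.appReal_apply_integral_smul_appReal' (integrable_resolventKernelAt_of_ne hz)]

/-- **`R(z)` preserves `D(H)` and commutes with the generator there**:
`R(z) x ∈ D(H)` and `iH (R(z) x) = R(z) (iH x)` for `x ∈ D(H)`. [folklore] -/
theorem resolventAt_mem_generator_domain {z : ℂ} (hz : z.im ≠ 0) (U : OneParameterUnitaryGroup H)
    (x : (OneParameterGroup.generator U.toStrongContRepresentation).domain) :
    ∃ h : resolventAt U z x ∈ (OneParameterGroup.generator U.toStrongContRepresentation).domain,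
      OneParameterGroup.generator U.toStrongContRepresentation ⟨_, h⟩ =
        resolventAt U z (OneParameterGroup.generator U.toStrongContRepresentation x) := by
  obtain ⟨h, hgen⟩ :=
    U.integral_smul_appReal_mem_generator_domain (integrable_resolventKernelAt_of_ne hz) x
  have e : ∀ f : H, resolventAt U z f = ∫ a, resolventKernelAt z a • U.appReal a f :=
    resolventAt_apply_of_ne hz U
  refine ⟨by rw [e]; exact h, ?_⟩
  rw [e (OneParameterGroup.generator U.toStrongContRepresentation x), ← hgen]
  congr 1
  exact Subtype.ext (e x)

/-- **`R(z)` maps the whole space into `D(H)`, with `iH (R(z) f) = i f + i z R(z) f`**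
(i.e. `(H - z) R(z) f = f`): for `x ∈ D(H)` this is §2 plus commutation with the generator; the
general case follows because the generator is closed (`C0Semigroup.isClosed_generator_holds`),
`D(H)` is dense and `R(z)` is bounded. [folklore] -/
theorem resolventAt_mem_generator_domain' {z : ℂ} (hz : z.im ≠ 0) (U : OneParameterUnitaryGroup H)
    (f : H) :
    ∃ h : resolventAt U z f ∈ (OneParameterGroup.generator U.toStrongContRepresentation).domain,
      OneParameterGroup.generator U.toStrongContRepresentation ⟨_, h⟩ =
        I • f + (I * z) • resolventAt U z f := by
  set gen := OneParameterGroup.generator U.toStrongContRepresentation with hgen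
  have hclosed : IsClosed (gen.graph : Set (H × H)) :=
    C0Semigroup.isClosed_generator_holds (OneParameterGroup.toC0Semigroup U.toStrongContRepresentation)
  have hdense : Dense (gen.domain : Set H) :=
    OneParameterGroup.dense_generator_domain U.toStrongContRepresentation
  -- the continuous map `g ↦ (R g, i g + i z R g)` sends `D(H)` into the graph
  set Φ : H → H × H := fun g => (resolventAt U z g, I • g + (I * z) • resolventAt U z g) with hΦ
  have hΦc : Continuous Φ := by
    simp only [hΦ]
    fun_prop
  have hmem : ∀ g ∈ (gen.domain : Set H), Φ g ∈ (gen.graph : Set (H × H)) := by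
    intro g hg
    obtain ⟨h, hval⟩ := resolventAt_mem_generator_domain hz U ⟨g, hg⟩
    rw [SetLike.mem_coe, LinearPMap.mem_graph_iff]
    refine ⟨⟨_, h⟩, rfl, ?_⟩
    rw [hval, resolventAt_generator_of_ne hz U ⟨g, hg⟩]
  have hlim : Φ f ∈ (gen.graph : Set (H × H)) := by
    haveI : (𝓝[(gen.domain : Set H)] f).NeBot := mem_closure_iff_nhdsWithin_neBot.1 (hdense f)
    have ht : Tendsto Φ (𝓝[(gen.domain : Set H)] f) (𝓝 (Φ f)) :=
      (hΦc.tendsto f).mono_left nhdsWithin_le_nhds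
    exact hclosed.mem_of_tendsto ht (eventually_mem_nhdsWithin.mono hmem)
  rw [SetLike.mem_coe, LinearPMap.mem_graph_iff] at hlim
  obtain ⟨y, hy1, hy2⟩ := hlim
  have hy : (y : H) = resolventAt U z f := hy1
  refine ⟨hy ▸ y.2, ?_⟩
  have : (⟨resolventAt U z f, hy ▸ y.2⟩ : gen.domain) = y := Subtype.ext hy.symm
  rw [this, hy2]

/-- **`R(z) f ∈ D(H)` and `H (R(z) f) = f + z R(z) f`**, i.e. `(H - z)(H - z)⁻¹ = 1` on the whole
space, for every non-real `z`. [folklore] -/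
theorem resolventAt_mem_hamiltonian_domain {z : ℂ} (hz : z.im ≠ 0) (U : OneParameterUnitaryGroup H)
    (f : H) :
    ∃ h : resolventAt U z f ∈ U.hamiltonian.domain,
      U.hamiltonian ⟨_, h⟩ = f + z • resolventAt U z f := by
  obtain ⟨h, hval⟩ := resolventAt_mem_generator_domain' hz U f
  refine ⟨h, ?_⟩
  rw [hamiltonian_apply]
  change (-I) • OneParameterGroup.generator U.toStrongContRepresentation ⟨_, h⟩ = _
  rw [hval, smul_add, smul_smul, smul_smul]
  have h1 : -I * I = (1 : ℂ) := by rw [neg_mul, Complex.I_mul_I, neg_neg]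
  have h2 : -I * (I * z) = z := by rw [← mul_assoc, h1, one_mul]
  rw [h1, h2, one_smul]

/-! ## §3. `R(-i)` is the tree's `resolventNegI` -/

/-- The kernels agree: `resolventKernelAt (-i) = resolventKernel` (`-i e^{-t}` on `t ≥ 0`). [folklore] -/
theorem resolventKernelAt_neg_I : resolventKernelAt (-I) = resolventKernel := by
  funext t
  have h : (-I : ℂ).im < 0 := by simp
  simp only [resolventKernelAt, if_pos h, resolventKernel]
  by_cases ht : 0 ≤ t
  · rw [if_pos ht, if_pos ht, Complex.ofReal_exp, Complex.ofReal_neg]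
    congr 2
    ring_nf
    rw [Complex.I_sq]
    ring
  · rw [if_neg ht, if_neg ht]

/-- **`(H - (-i))⁻¹ = (H + i)⁻¹`**: `resolventAt U (-i)` is the tree's `resolventNegI U`, the
operator on which `HamiltonianOfClassC1/C11 U A` are stated. [folklore] -/
theorem resolventAt_neg_I (U : OneParameterUnitaryGroup H) : resolventAt U (-I) = U.resolventNegI := by
  rw [resolventAt, resolventNegI, resolventKernelAt_neg_I]

/-- `H ∈ C¹(A)` iff `R(-i) ∈ C¹(A; H)` (unfolding through `resolventAt_neg_I`). [folklore] -/
theorem hamiltonianOfClassC1_iff (U A : OneParameterUnitaryGroup H) :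
    U.HamiltonianOfClassC1 A ↔ A.IsOfClassC1 (resolventAt U (-I)) := by
  rw [resolventAt_neg_I]; rfl

/-- `H ∈ 𝒞^{1,1}(A)` iff `R(-i) ∈ 𝒞^{1,1}(A; H)`. [folklore] -/
theorem hamiltonianOfClassC11_iff (U A : OneParameterUnitaryGroup H) :
    U.HamiltonianOfClassC11 A ↔ A.IsOfClassC11 (resolventAt U (-I)) := by
  rw [resolventAt_neg_I]; rfl

/-! ## §4. Headline (registered helper stub) -/

/-- **`(H - z)(H - z)⁻¹ = 1` on the whole space, headline form** (all binders explicit; registered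
helper stub of `stub_mourreThresholdLAP`): for non-real `z` and every `f`, `R(z) f ∈ D(H)` and
`H (R(z) f) = f + z R(z) f`. [folklore] -/
theorem hamiltonian_resolventAt_apply :
    ∀ (K : Type) [NormedAddCommGroup K] [InnerProductSpace ℂ K] [CompleteSpace K]
      (U : Literature.Analysis.UnboundedOperators.OneParameterUnitaryGroup K) (z : ℂ) (f : K),
      z.im ≠ 0 →
        ∃ h : Summit.AtomisticToContinuum.FouriersLaw.Theorems.MourreDissolution.resolventAt U z f ∈
            U.hamiltonian.domain,
          U.hamiltonian
              ⟨Summit.AtomisticToContinuum.FouriersLaw.Theorems.MourreDissolution.resolventAt U z f, h⟩ =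
            f + z • Summit.AtomisticToContinuum.FouriersLaw.Theorems.MourreDissolution.resolventAt U z f := by
  intro K _ _ _ U z f hz
  exact resolventAt_mem_hamiltonian_domain hz U f

end Summit.AtomisticToContinuum.FouriersLaw.Theorems.MourreDissolution
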